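import Summits.CriticalPhenomena.SAWScalingLimit.Theses.SAWTwistedSelfEnergy
import Literature.Probability.RandomPlanarGeometry.CurveTortuosity
import Literature.Probability.LatticeModels.LatticeInterface
import Summits.CriticalPhenomena.SAWScalingLimit.Theorems.SAWRenewalTightnessShellCrossingBoundSocketTransfer
import Summits.CriticalPhenomena.SAWScalingLimit.Theorems.SAWRenewalTightnessShellCrossingBoundOfPinchAway
import Summits.CriticalPhenomena.SAWScalingLimit.Theorems.SAWRenewalTightnessTightOfShellCrossing
import HarnessLib

/-!
# Sketch — crux-ideate round 1, ideator 2, crux `EventualTight` (stmt-CriticalPhenomena-1881)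

Card `unordered-markov-fibres` ("condition on WHERE, not WHEN").  Contents:

* `OutAgree`, `UMA` — the ONE open statement of the line: the unordered-Markov fibre atom (for every
  fibre of the outside trace at radius `2s`, the JOINT event "`k` traversals of `D(y; ts, s)` but `< m`
  of `D(y; 6s/5, 2s)`" has conditional probability `≤ θ`; thresholds per `(D, a, b, y, s, t, m)`).
* `UMAInductionStep` — PROVED (`umaInductionStep_holds`): coarse tightness at scale `2s` + the atom at
  scale `s` ⇒ fine tightness at scale `s`, by the fibre decomposition of the critical SAW law
  (`law_fiber_decomp`, `law_le_add_of_fibrewise`; discrete σ-algebra, sums of point masses).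
* `PerShellDecayOfUMA` — PROVED (`perShellDecayOfUMA_holds`): `UMA →` per-shell eventual tightness of
  the traversal count for EVERY shell, by induction down the scale ranges `(R₀/2ⁿ, R₀]` from the free
  base "shells reaching beyond `Ω̄` are never traversed" (`not_hasTraversals_far`).
* `eventualTight_of_UMA` — PROVED, kernel-closed modulo `UMA` only (axioms propext/choice/Quot.sound):
  `UMA → SAWTwistedSelfEnergy.EventualTight` BY NAME, through the landed
  `Theorems.shellCrossing_of_perShellDecay`, `Theorems.TightOfShellCrossing_proof` and the Literature
  bridge `isTightAlongMesh_of_isTightMeasureSet_image`.  No restriction positivity (E, stmt-17587), no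
  exterior quantifier (X2c₁, stmt-17940), no virginization transport, no enlargement.
* `PureDiscChordTight` — the bounded-piece, pure-disc sub-case (cheapest falsifier; strictly weaker than
  stmt-17940).

This is NOT a registered skeleton (crux-ideate files none); it is the card's first lemma, proved.
-/

noncomputable section

open MeasureTheory Filter Topology Set Metric
open scoped ENNReal NNReal unitInterval
open Literature.Probability.RandomPlanarGeometry Literature.Probability.LatticeModels

namespace Summit.CriticalPhenomena.SAWScalingLimit.Cruxes.EventualTight.IdeatorR1K2

/-- The polyline of a domain SAW at mesh `δ`, as a curve. -/
def polyline {Ω : Set ℂ} {δ : ℝ} {a b : Site 2} (γ : SAW.DomainSAW Ω δ a b) : Curve ℂ :=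
  ⟨γ.walk.toCurve (meshPoint δ)⟩

/-- **Outside agreement** (the fibre of the UNORDERED outside trace): `γ` and `γ₀` use exactly the same
lattice edges among those edges that are NOT strictly inside the open disc `B(y, r)` (an edge is "not
strictly inside" when one of its endpoints has mesh image at distance `≥ r` from `y`).  Conditioning on
this fibre freezes WHERE the walk is outside the disc — every outside piece, the crossing edges, hence the
entry/exit vertices and their pairing up to the finitely many re-pairings compatible with one path — and
resamples EVERYTHING inside, including the inside portions of the "past".  No wall can be built inside the
resampled disc by the data. -/
def OutAgree {Ω : Set ℂ} {δ : ℝ} {a b : Site 2} (y : ℂ) (r : ℝ)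
    (γ γ₀ : SAW.DomainSAW Ω δ a b) : Prop :=
  ∀ e : Sym2 (Site 2), (∃ v : Site 2, v ∈ e ∧ r ≤ dist (meshPoint δ v) y) →
    (e ∈ γ.walk.edges ↔ e ∈ γ₀.walk.edges)

/-- **UMA — the unordered-Markov fibre atom** (card `unordered-markov-fibres`, the ONE open statement of
the line).  For every Dobrushin domain with an endpoint approximation, every centre `y`, scale `s`,
inner aspect `t ∈ (0,1)`, coarse budget `m` and `θ > 0` there are a threshold `k` and a mesh bound `δ₀`
such that, for every mesh `δ ≤ δ₀` and EVERY reference walk `γ₀` (every fibre of the outside trace at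
radius `2s`), the critical SAW law gives the JOINT event "`k` separate traversals of the fine shell
`D(y; t s, s)` but fewer than `m` of the coarse shell `D(y; 6s/5, 2s)`" at most `θ` times the mass of
the fibre.  Thresholds depend on `(D, a, b, y, s, t, m)` (Disproof §3/§5 honoured: no uniformity over
domains, approximations or shells; the Jordan loop bounds the forced count inside `B(y,2s) ∩ Ω`). -/
def UMA : Prop :=
  ∀ (D : DobrushinDomain) (a b : ℝ → Site 2), SAW.IsEndpointApprox D a b →
    ∀ (y : ℂ) (s t : ℝ), 0 < s → 0 < t → t < 1 → ∀ (m : ℕ) (θ : ℝ), 0 < θ →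
      ∃ (k : ℕ) (δ₀ : ℝ), 0 < δ₀ ∧ ∀ δ ∈ Set.Ioc (0 : ℝ) δ₀,
        ∀ γ₀ : SAW.DomainSAW D.carrier δ (a δ) (b δ),
          SAW.law D.carrier δ (a δ) (b δ)
              {γ | OutAgree y (2 * s) γ γ₀ ∧ (polyline γ).HasTraversals k y (t * s) s ∧
                ¬ (polyline γ).HasTraversals m y (6 * s / 5) (2 * s)}
            ≤ ENNReal.ofReal θ *
              SAW.law D.carrier δ (a δ) (b δ) {γ | OutAgree y (2 * s) γ γ₀}

/-- Per-shell eventual tightness of the traversal count for ALL shells (the hypothesis `hP` of the landed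
`Theorems.shellCrossing_of_perShellDecay`, quantified over `(D, a, b)`); by the landed chain
`shellCrossing_of_perShellDecay → TightOfShellCrossing_proof → isTightAlongMesh_of_isTightMeasureSet_image`
it implies the crux `SAWTwistedSelfEnergy.EventualTight`. -/
def PerShellDecayAll : Prop :=
  ∀ (D : DobrushinDomain) (a b : ℝ → Site 2), SAW.IsEndpointApprox D a b →
    ∀ (x : ℂ) (ρ R : ℝ), 0 < ρ → ρ < R → ∀ ε : ℝ, 0 < ε →
      ∃ (k : ℕ) (δ₁ : ℝ), 0 < δ₁ ∧ ∀ δ ∈ Set.Ioc (0 : ℝ) δ₁,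
        SAW.law D.carrier δ (a δ) (b δ) {γ | (polyline γ).HasTraversals k x ρ R} ≤ ENNReal.ofReal ε

/-- **First lemma of the card (the glue, provable now): `UMA → PerShellDecayAll`.**  Proof plan:
fix `(D, a, b, y)`; induct DOWN the dyadic scales `s = s₀ 2^{-i}` from a base scale `s₀` with
`t·s₀ > sup_{z ∈ Ω̄} |z − y|` (no polyline point in the base shells, zero traversals, landed
`exists_mem_closure_of_hasTraversals`); the step is the fibre decomposition
`P[T_fine ≥ k] ≤ P[T_coarse ≥ m] + Σ_fibres P[fibre ∧ T_fine ≥ k ∧ T_coarse < m] ≤ θ/2 + (θ/2)·Σ_fibres P[fibre]`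
with `T_coarse` = the aspect-`5/3` shell one scale up (itself a target `t = 3/5` of the previous step);
arbitrary shells `D(x; ρ, R)` contain a dyadic `D(x; t s, s)` and inherit its bound
(`Curve.HasTraversals` monotone under shell inclusion). -/
def PerShellDecayOfUMA : Prop := UMA → PerShellDecayAll

/-- **The induction step in isolation** (one centre, one scale): coarse tightness at scale `2s` and the
atom at scale `s` give fine tightness at scale `s`.  Elementary measure theory on a finite space (the
fibres `{γ | OutAgree y (2s) γ γ₀}` partition the SAWs of `Ω_δ`). -/
def UMAInductionStep : Prop :=
  ∀ (D : DobrushinDomain) (a b : ℝ → Site 2), SAW.IsEndpointApprox D a b →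
    ∀ (y : ℂ) (s t : ℝ), 0 < s → 0 < t → t < 1 →
      (∀ ε : ℝ, 0 < ε → ∃ (m : ℕ) (δ₁ : ℝ), 0 < δ₁ ∧ ∀ δ ∈ Set.Ioc (0 : ℝ) δ₁,
        SAW.law D.carrier δ (a δ) (b δ)
          {γ | (polyline γ).HasTraversals m y (6 * s / 5) (2 * s)} ≤ ENNReal.ofReal ε) →
      (∀ (m : ℕ) (θ : ℝ), 0 < θ → ∃ (k : ℕ) (δ₀ : ℝ), 0 < δ₀ ∧ ∀ δ ∈ Set.Ioc (0 : ℝ) δ₀,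
        ∀ γ₀ : SAW.DomainSAW D.carrier δ (a δ) (b δ),
          SAW.law D.carrier δ (a δ) (b δ)
              {γ | OutAgree y (2 * s) γ γ₀ ∧ (polyline γ).HasTraversals k y (t * s) s ∧
                ¬ (polyline γ).HasTraversals m y (6 * s / 5) (2 * s)}
            ≤ ENNReal.ofReal θ * SAW.law D.carrier δ (a δ) (b δ) {γ | OutAgree y (2 * s) γ γ₀}) →
      ∀ ε : ℝ, 0 < ε → ∃ (k : ℕ) (δ₁ : ℝ), 0 < δ₁ ∧ ∀ δ ∈ Set.Ioc (0 : ℝ) δ₁,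
        SAW.law D.carrier δ (a δ) (b δ)
          {γ | (polyline γ).HasTraversals k y (t * s) s} ≤ ENNReal.ofReal ε

/-- **The pure-disc special case of the atom (cheapest falsifier; lattice units, no domain, no mesh):**
`m` mutually avoiding `x_c`-weighted self-avoiding paths in the closed lattice disc `B̄(z₀, 2N)` with
prescribed rim endpoints never cross the coarse shell (they start on the rim and end on the rim: a piece
reaching `B(z₀, 6N/5)` costs two coarse traversals), so the bounded-piece sub-case of UMA reads: for
`m` pieces, `P[k traversals of D(z₀; tN, N)] ≤ θ` uniformly over rim endpoints and pairings.  Typed for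
ONE piece (`m = 1`): the pure-disc chord atom, STRICTLY WEAKER than item stmt-CriticalPhenomena-17940
(exterior `Λ = ∅`, doors on the rim). -/
def PureDiscChordTight : Prop :=
  ∀ (t θ : ℝ), 0 < t → t < 1 → 0 < θ →
    ∃ (k : ℕ) (N₀ : ℝ), 0 < N₀ ∧
      ∀ (z₀ : ℂ) (N : ℝ) (c c' : Site 2), N₀ ≤ N →
        dist (Site.toComplex c) z₀ ≤ 2 * N → dist (Site.toComplex c') z₀ ≤ 2 * N →
        ∑' p : {p : {p : (zdGraph 2).Walk c c' // p.IsPath ∧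
              ∀ v ∈ p.support, dist (Site.toComplex v) z₀ ≤ 2 * N} //
              (⟨p.1.toCurve Site.toComplex⟩ : Curve ℂ).HasTraversals k z₀ (t * N) N},
            ENNReal.ofReal (SAW.criticalFugacity ^ p.1.1.length) ≤
          ENNReal.ofReal θ *
            ∑' p : {p : (zdGraph 2).Walk c c' // p.IsPath ∧
                ∀ v ∈ p.support, dist (Site.toComplex v) z₀ ≤ 2 * N},
              ENNReal.ofReal (SAW.criticalFugacity ^ p.1.length)


/-! ## The induction step, PROVED (fibre decomposition of the critical SAW law) -/

section StepProof

variable {Ω : Set ℂ} {δ : ℝ} {a b : Site 2}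

/-- The outside-edge signature of a SAW: the set of its lattice edges not strictly inside `B(y, r)`. -/
def outSig (y : ℂ) (r : ℝ) (γ : SAW.DomainSAW Ω δ a b) : Set (Sym2 (Site 2)) :=
  {e | (∃ v : Site 2, v ∈ e ∧ r ≤ dist (meshPoint δ v) y) ∧ e ∈ γ.walk.edges}

/-- Two SAWs agree outside iff they have the same outside-edge signature; in particular
`OutAgree y r` is an equivalence relation and its classes are the fibres of `outSig y r`. -/
theorem outAgree_iff_outSig (y : ℂ) (r : ℝ) (γ γ₀ : SAW.DomainSAW Ω δ a b) :
    OutAgree y r γ γ₀ ↔ outSig y r γ = outSig y r γ₀ := by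
  constructor
  · intro h
    ext e
    simp only [outSig, Set.mem_setOf_eq]
    constructor
    · rintro ⟨he, hm⟩
      exact ⟨he, (h e he).1 hm⟩
    · rintro ⟨he, hm⟩
      exact ⟨he, (h e he).2 hm⟩
  · intro h e he
    have h' := Set.ext_iff.1 h e
    simp only [outSig, Set.mem_setOf_eq] at h'
    constructor
    · intro hm
      exact (h'.1 ⟨he, hm⟩).2
    · intro hm
      exact (h'.2 ⟨he, hm⟩).2

/-- The critical weight of a set of SAWs is the sum of the point weights (discrete σ-algebra). -/
theorem weight_apply_eq_tsum (S : Set (SAW.DomainSAW Ω δ a b)) :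
    SAW.weight Ω δ a b S =
      ∑' γ, S.indicator (fun γ => ENNReal.ofReal (SAW.criticalFugacity ^ γ.length)) γ := by
  rw [SAW.weight, Measure.sum_apply _ MeasurableSpace.measurableSet_top]
  refine tsum_congr fun γ => ?_
  rw [Measure.smul_apply, Measure.dirac_apply' _ MeasurableSpace.measurableSet_top, smul_eq_mul]
  by_cases h : γ ∈ S
  · simp [h]
  · simp [h]

/-- The critical SAW law of a set is the sum of its point masses. -/
theorem law_apply_eq_tsum (S : Set (SAW.DomainSAW Ω δ a b)) :
    SAW.law Ω δ a b S = ∑' γ, S.indicator (fun γ => SAW.law Ω δ a b {γ}) γ := by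
  have hL : ∀ T : Set (SAW.DomainSAW Ω δ a b), SAW.law Ω δ a b T =
      (SAW.weight Ω δ a b Set.univ)⁻¹ * SAW.weight Ω δ a b T := by
    intro T
    rw [SAW.law, Measure.smul_apply, smul_eq_mul]
  rw [hL S, weight_apply_eq_tsum S, ← ENNReal.tsum_mul_left]
  refine tsum_congr fun γ => ?_
  by_cases h : γ ∈ S
  · rw [Set.indicator_of_mem h, Set.indicator_of_mem h, hL {γ}, SAW.weight_singleton]
  · simp [h]

/-- Regrouping a sum along the fibres of a map. -/
theorem tsum_fiberwise {α β : Type*} (π : α → β) (g : α → ℝ≥0∞) :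
    ∑' x, g x = ∑' L, ∑' x : {x // π x = L}, g x.1 := by
  rw [← (Equiv.sigmaFiberEquiv π).tsum_eq g, ENNReal.tsum_sigma']
  rfl

/-- A fibre sum of an indicator is the sum of the indicator of the fibre slice. -/
theorem tsum_fiber_indicator {α β : Type*} (π : α → β) (g : α → ℝ≥0∞) (S : Set α) (L : β) :
    ∑' x : {x // π x = L}, S.indicator g x.1 = ∑' x, ({x | π x = L} ∩ S).indicator g x := by
  rw [← Set.indicator_indicator]
  exact (tsum_subtype ({x | π x = L} : Set α) (S.indicator g))

/-- **Fibre decomposition of the critical SAW law** along the outside-edge signature. -/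
theorem law_fiber_decomp (y : ℂ) (r : ℝ) (S : Set (SAW.DomainSAW Ω δ a b)) :
    SAW.law Ω δ a b S =
      ∑' L : Set (Sym2 (Site 2)), SAW.law Ω δ a b ({γ | outSig y r γ = L} ∩ S) := by
  rw [law_apply_eq_tsum S, tsum_fiberwise (outSig y r)]
  refine tsum_congr fun L => ?_
  rw [law_apply_eq_tsum ({γ | outSig y r γ = L} ∩ S)]
  exact tsum_fiber_indicator (outSig y r) _ S L

/-- The critical SAW law has total mass `≤ 1` (it is `0` or a probability measure). -/
theorem law_univ_le_one : SAW.law Ω δ a b Set.univ ≤ 1 := by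
  rw [SAW.law, Measure.smul_apply, smul_eq_mul]
  rcases eq_or_ne (SAW.weight Ω δ a b Set.univ) 0 with h | h
  · simp [h]
  rcases eq_or_ne (SAW.weight Ω δ a b Set.univ) ⊤ with h' | h'
  · simp [h']
  · rw [ENNReal.inv_mul_cancel h h']

/-- **Core of the induction step**: a fibrewise bound on the joint event `A ∩ Cᶜ` (uniform over the
fibres of the unordered outside trace) gives `P[A] ≤ P[C] + θ`. -/
theorem law_le_add_of_fibrewise (y : ℂ) (r : ℝ) (A C : Set (SAW.DomainSAW Ω δ a b)) (θ : ℝ≥0∞)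
    (hU : ∀ γ₀ : SAW.DomainSAW Ω δ a b,
      SAW.law Ω δ a b ({γ | OutAgree y r γ γ₀} ∩ (A ∩ Cᶜ)) ≤
        θ * SAW.law Ω δ a b {γ | OutAgree y r γ γ₀}) :
    SAW.law Ω δ a b A ≤ SAW.law Ω δ a b C + θ := by
  have hper : ∀ L : Set (Sym2 (Site 2)),
      SAW.law Ω δ a b ({γ | outSig y r γ = L} ∩ (A ∩ Cᶜ)) ≤
        θ * SAW.law Ω δ a b ({γ | outSig y r γ = L} ∩ Set.univ) := by
    intro L
    rw [Set.inter_univ]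
    by_cases hne : ∃ γ₀ : SAW.DomainSAW Ω δ a b, outSig y r γ₀ = L
    · obtain ⟨γ₀, hγ₀⟩ := hne
      have hF : {γ : SAW.DomainSAW Ω δ a b | outSig y r γ = L} = {γ | OutAgree y r γ γ₀} := by
        ext γ
        simp only [Set.mem_setOf_eq]
        rw [outAgree_iff_outSig, hγ₀]
      rw [hF]
      exact hU γ₀
    · have hF : {γ : SAW.DomainSAW Ω δ a b | outSig y r γ = L} = ∅ :=
        Set.eq_empty_iff_forall_notMem.2 fun γ hγ => hne ⟨γ, hγ⟩
      rw [hF, Set.empty_inter, measure_empty]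
      exact bot_le
  have h3 : SAW.law Ω δ a b (A ∩ Cᶜ) ≤ θ := by
    calc SAW.law Ω δ a b (A ∩ Cᶜ)
        = ∑' L, SAW.law Ω δ a b ({γ | outSig y r γ = L} ∩ (A ∩ Cᶜ)) := law_fiber_decomp y r _
      _ ≤ ∑' L, θ * SAW.law Ω δ a b ({γ | outSig y r γ = L} ∩ Set.univ) :=
          ENNReal.tsum_le_tsum hper
      _ = θ * SAW.law Ω δ a b Set.univ := by
          rw [ENNReal.tsum_mul_left, ← law_fiber_decomp y r Set.univ]
      _ ≤ θ * 1 := by gcongr; exact law_univ_le_one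
      _ = θ := mul_one _
  calc SAW.law Ω δ a b A ≤ SAW.law Ω δ a b (C ∪ (A ∩ Cᶜ)) :=
        measure_mono fun γ hγ => by
          by_cases hc : γ ∈ C
          · exact Or.inl hc
          · exact Or.inr ⟨hγ, hc⟩
    _ ≤ SAW.law Ω δ a b C + SAW.law Ω δ a b (A ∩ Cᶜ) := measure_union_le _ _
    _ ≤ SAW.law Ω δ a b C + θ := by gcongr

end StepProof

/-- **The induction step holds** (coarse tightness at scale `2s` + the atom at scale `s` ⇒ fine tightness
at scale `s`): elementary, by the fibre decomposition `law_le_add_of_fibrewise`. -/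
theorem umaInductionStep_holds : UMAInductionStep := by
  intro D a b _ y s t _ _ _ hC hU ε hε
  have hε2 : 0 < ε / 2 := by positivity
  obtain ⟨m, δ₁, hδ₁, hCm⟩ := hC (ε / 2) hε2
  obtain ⟨k, δ₀, hδ₀, hUk⟩ := hU m (ε / 2) hε2
  refine ⟨k, min δ₁ δ₀, lt_min hδ₁ hδ₀, fun δ hδ => ?_⟩
  have hδ1 : δ ∈ Set.Ioc (0 : ℝ) δ₁ := ⟨hδ.1, hδ.2.trans (min_le_left _ _)⟩
  have hδ0 : δ ∈ Set.Ioc (0 : ℝ) δ₀ := ⟨hδ.1, hδ.2.trans (min_le_right _ _)⟩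
  have hfib : ∀ γ₀ : SAW.DomainSAW D.carrier δ (a δ) (b δ),
      SAW.law D.carrier δ (a δ) (b δ)
          ({γ | OutAgree y (2 * s) γ γ₀} ∩
            ({γ | (polyline γ).HasTraversals k y (t * s) s} ∩
              {γ | (polyline γ).HasTraversals m y (6 * s / 5) (2 * s)}ᶜ)) ≤
        ENNReal.ofReal (ε / 2) * SAW.law D.carrier δ (a δ) (b δ) {γ | OutAgree y (2 * s) γ γ₀} := by
    intro γ₀
    have h := hUk δ hδ0 γ₀
    have hset : ({γ | OutAgree y (2 * s) γ γ₀} ∩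
        ({γ : SAW.DomainSAW D.carrier δ (a δ) (b δ) | (polyline γ).HasTraversals k y (t * s) s} ∩
          {γ | (polyline γ).HasTraversals m y (6 * s / 5) (2 * s)}ᶜ)) =
        {γ | OutAgree y (2 * s) γ γ₀ ∧ (polyline γ).HasTraversals k y (t * s) s ∧
          ¬ (polyline γ).HasTraversals m y (6 * s / 5) (2 * s)} := by
      ext γ
      simp only [Set.mem_inter_iff, Set.mem_setOf_eq, Set.mem_compl_iff]
    rw [hset]
    exact h
  have hstep := law_le_add_of_fibrewise y (2 * s)
    {γ : SAW.DomainSAW D.carrier δ (a δ) (b δ) | (polyline γ).HasTraversals k y (t * s) s}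
    {γ | (polyline γ).HasTraversals m y (6 * s / 5) (2 * s)} (ENNReal.ofReal (ε / 2)) hfib
  calc SAW.law D.carrier δ (a δ) (b δ) {γ | (polyline γ).HasTraversals k y (t * s) s}
      ≤ SAW.law D.carrier δ (a δ) (b δ) {γ | (polyline γ).HasTraversals m y (6 * s / 5) (2 * s)} +
          ENNReal.ofReal (ε / 2) := hstep
    _ ≤ ENNReal.ofReal (ε / 2) + ENNReal.ofReal (ε / 2) := by gcongr; exact hCm δ hδ1
    _ = ENNReal.ofReal ε := by
        rw [← ENNReal.ofReal_add hε2.le hε2.le, add_halves]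


/-! ## The glue, PROVED: `UMA → PerShellDecayAll` (coarse-to-fine induction with the trivial base) -/

section GlueProof

open Summit.CriticalPhenomena.SAWScalingLimit.Theorems (exists_mem_closure_of_hasTraversals)

/-- **No traversal of a far shell.**  If `Ω̄ ⊆ B(y, R₀)` then no SAW polyline of `Ω_δ` makes even one
traversal of a genuine shell `D(y; r, R)` with `R₀ ≤ R`: the outer endpoint of a traversal is a point of
the polyline at distance `≥ R` from `y`, and every point of the polyline of a non-trivial walk lies in `Ω̄`
(for the trivial walk the polyline is constant and traverses no genuine shell); both facts are read off
the landed `exists_mem_closure_of_hasTraversals` applied to the one-strand traversal of `D(p; 0, R − r)`. -/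
theorem not_hasTraversals_far {Ω : Set ℂ} {δ : ℝ} {a b : Site 2} {y : ℂ} {R₀ r R : ℝ}
    (hΩ : closure Ω ⊆ Metric.ball y R₀) (hrR : r < R) (hR : R₀ ≤ R)
    (γ : SAW.DomainSAW Ω δ a b) {k : ℕ} (hk : k ≠ 0) :
    ¬ (polyline γ).HasTraversals k y r R := by
  rintro ⟨s, t, hst, -⟩
  obtain ⟨i⟩ : Nonempty (Fin k) := Fin.pos_iff_nonempty.1 (Nat.pos_of_ne_zero hk)
  have hRr : (0 : ℝ) < R - r := by linarith
  -- a polyline point `p` that is in `Ω̄` (witnessed at distance `0`) cannot be at distance `≥ R` from `y`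
  have main : ∀ p : ℂ, (∃ z ∈ closure Ω, dist z p ≤ 0) → R ≤ dist p y → False := by
    rintro p ⟨z, hz, hzp⟩ hp
    have hzp' : z = p := dist_le_zero.1 hzp
    subst hzp'
    have hb := hΩ hz
    rw [Metric.mem_ball] at hb
    linarith
  have hsep : ∀ ⦃j j' : Fin 1⦄, j < j' → (fun _ : Fin 1 => t i) j < (fun _ : Fin 1 => s i) j' := by
    intro j j' hjj'
    exact absurd hjj' (by rw [Subsingleton.elim j j']; exact lt_irrefl _)
  rcases (hst i).2 with ⟨h1, h2⟩ | ⟨h1, h2⟩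
  · -- inner endpoint at `s i`, outer endpoint `p = γ(t i)`
    refine main ((polyline γ) (t i)) ?_ h2
    refine exists_mem_closure_of_hasTraversals γ.walk one_ne_zero hRr ?_
    refine ⟨fun _ => s i, fun _ => t i, fun _ => ⟨(hst i).1, Or.inr ⟨?_, ?_⟩⟩, hsep⟩
    · have htri := dist_triangle ((polyline γ) (t i)) ((polyline γ) (s i)) y
      rw [dist_comm ((polyline γ) (t i)) ((polyline γ) (s i))] at htri
      show R - r ≤ dist ((polyline γ) (s i)) ((polyline γ) (t i))
      linarith
    · show dist ((polyline γ) (t i)) ((polyline γ) (t i)) ≤ 0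
      rw [dist_self]
  · -- outer endpoint `p = γ(s i)`, inner endpoint at `t i`
    refine main ((polyline γ) (s i)) ?_ h1
    refine exists_mem_closure_of_hasTraversals γ.walk one_ne_zero hRr ?_
    refine ⟨fun _ => s i, fun _ => t i, fun _ => ⟨(hst i).1, Or.inl ⟨?_, ?_⟩⟩, hsep⟩
    · show dist ((polyline γ) (s i)) ((polyline γ) (s i)) ≤ 0
      rw [dist_self]
    · have htri := dist_triangle ((polyline γ) (s i)) ((polyline γ) (t i)) y
      show R - r ≤ dist ((polyline γ) (t i)) ((polyline γ) (s i))
      rw [dist_comm ((polyline γ) (t i)) ((polyline γ) (s i))]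
      linarith

/-- **The glue holds: `UMA → PerShellDecayAll`.**  Fix `(D, a, b)` and the centre `x`; take `R₀` with
`Ω̄ ⊆ B(x, R₀)`.  Shells with outer radius `≥ R₀` are never traversed (`not_hasTraversals_far`).  For the
others, induct on `n` over the scale ranges `s ∈ (R₀/2ⁿ, R₀]`: the coarse shell `D(x; 6s/5, 2s)` of the
step at scale `s` either has outer radius `2s ≥ R₀` (trivially tight) or is the target `t = 3/5` at scale
`2s ∈ (R₀/2ⁿ⁻¹, R₀]` of the previous range; the step itself is `umaInductionStep_holds`. -/
theorem perShellDecayOfUMA_holds : PerShellDecayOfUMA := by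
  intro hUMA D a b hab x ρ R hρ hρR ε hε
  obtain ⟨R₁, hR₁⟩ := (D.isBounded.closure).subset_ball x
  set R₀ : ℝ := max R₁ 1 with hR₀def
  have hR₀pos : 0 < R₀ := lt_of_lt_of_le one_pos (le_max_right _ _)
  have hΩ : closure D.carrier ⊆ Metric.ball x R₀ :=
    hR₁.trans (Metric.ball_subset_ball (le_max_left _ _))
  -- far shells: never traversed
  have htriv : ∀ r R' : ℝ, r < R' → R₀ ≤ R' → ∀ ε' : ℝ, 0 < ε' →
      ∃ (k : ℕ) (δ₁ : ℝ), 0 < δ₁ ∧ ∀ δ ∈ Set.Ioc (0 : ℝ) δ₁,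
        SAW.law D.carrier δ (a δ) (b δ) {γ | (polyline γ).HasTraversals k x r R'} ≤
          ENNReal.ofReal ε' := by
    intro r R' hrR' hR' ε' _
    refine ⟨1, 1, one_pos, fun δ _ => ?_⟩
    have hempty : {γ : SAW.DomainSAW D.carrier δ (a δ) (b δ) |
        (polyline γ).HasTraversals 1 x r R'} = ∅ :=
      Set.eq_empty_iff_forall_notMem.2 fun γ hγ =>
        not_hasTraversals_far hΩ hrR' hR' γ one_ne_zero hγ
    rw [hempty, measure_empty]
    exact bot_le
  -- the induction over scale ranges
  have hclaim : ∀ n : ℕ, ∀ s : ℝ, R₀ / 2 ^ n < s → s ≤ R₀ → ∀ t : ℝ, 0 < t → t < 1 →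
      ∀ ε' : ℝ, 0 < ε' → ∃ (k : ℕ) (δ₁ : ℝ), 0 < δ₁ ∧ ∀ δ ∈ Set.Ioc (0 : ℝ) δ₁,
        SAW.law D.carrier δ (a δ) (b δ) {γ | (polyline γ).HasTraversals k x (t * s) s} ≤
          ENNReal.ofReal ε' := by
    intro n
    induction n with
    | zero =>
      intro s hs1 hs2
      rw [pow_zero, div_one] at hs1
      exact absurd hs2 (not_le.2 hs1)
    | succ n ih =>
      intro s hs1 hs2 t ht ht1
      have hs0 : 0 < s := lt_trans (div_pos hR₀pos (pow_pos two_pos _)) hs1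
      have hcoarse : ∀ ε' : ℝ, 0 < ε' → ∃ (m : ℕ) (δ₁ : ℝ), 0 < δ₁ ∧ ∀ δ ∈ Set.Ioc (0 : ℝ) δ₁,
          SAW.law D.carrier δ (a δ) (b δ)
              {γ | (polyline γ).HasTraversals m x (6 * s / 5) (2 * s)} ≤ ENNReal.ofReal ε' := by
        by_cases h2s : R₀ ≤ 2 * s
        · exact htriv (6 * s / 5) (2 * s) (by linarith) h2s
        · push Not at h2s
          have hrange : R₀ / 2 ^ n < 2 * s := by
            have e : R₀ / 2 ^ n = 2 * (R₀ / 2 ^ (n + 1)) := by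
              rw [pow_succ]
              field_simp
            rw [e]
            linarith
          have h := ih (2 * s) hrange h2s.le (3 / 5) (by norm_num) (by norm_num)
          have e : (3 : ℝ) / 5 * (2 * s) = 6 * s / 5 := by ring
          rw [e] at h
          exact h
      exact umaInductionStep_holds D a b hab x s t hs0 ht ht1 hcoarse (hUMA D a b hab x s t hs0 ht ht1)
  -- the given shell
  by_cases hfarR : R₀ ≤ R
  · exact htriv ρ R hρR hfarR ε hε
  · push Not at hfarR
    have hRpos : 0 < R := hρ.trans hρR
    obtain ⟨n, hn⟩ : ∃ n : ℕ, R₀ / 2 ^ n < R := by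
      obtain ⟨n, hn⟩ := exists_pow_lt_of_lt_one (div_pos hRpos hR₀pos) (by norm_num : (1 : ℝ) / 2 < 1)
      refine ⟨n, ?_⟩
      have h1 : R₀ / 2 ^ n = R₀ * (1 / 2) ^ n := by
        rw [div_eq_mul_inv, one_div, inv_pow]
      rw [h1]
      calc R₀ * (1 / 2) ^ n < R₀ * (R / R₀) := mul_lt_mul_of_pos_left hn hR₀pos
        _ = R := by field_simp
    have h := hclaim n R hn hfarR.le (ρ / R) (div_pos hρ hRpos) ((div_lt_one hRpos).2 hρR) ε hε
    have e : ρ / R * R = ρ := by field_simp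
    rw [e] at h
    exact h

end GlueProof

/-- **UMA closes the crux** (by name, at the bet route's decl): UMA ⇒ per-shell tightness (`perShellDecayOfUMA_holds`)
⇒ `ShellCrossingBound`-form (landed `Theorems.shellCrossing_of_perShellDecay`) ⇒ set-form eventual tightness
(landed `TightOfShellCrossing_proof`) ⇒ the along-the-mesh crux (Literature bridge). -/
theorem eventualTight_of_UMA (hUMA : UMA) :
    Summit.CriticalPhenomena.SAWScalingLimit.Theses.SAWTwistedSelfEnergy.EventualTight := by
  have hSCB : Summit.CriticalPhenomena.SAWScalingLimit.Theses.SAWRenewalTightness.ShellCrossingBound :=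
    fun D a b hab =>
      Summit.CriticalPhenomena.SAWScalingLimit.Theorems.shellCrossing_of_perShellDecay D a b
        (perShellDecayOfUMA_holds hUMA D a b hab)
  have hT := Summit.CriticalPhenomena.SAWScalingLimit.Theorems.TightOfShellCrossing_proof hSCB
  intro D a b hab
  obtain ⟨δ₀, hδ₀, hTight⟩ := hT D a b hab
  exact isTightAlongMesh_of_isTightMeasureSet_image
    (Eventually.of_forall fun δ => SAW.aemeasurable_curve D.carrier δ (a δ) (b δ)) hδ₀ hTight

end Summit.CriticalPhenomena.SAWScalingLimit.Cruxes.EventualTight.IdeatorR1K2
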